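import Summits.QuantumFields.YangMills.Theorems.BalabanUVNodesN22WindowedDecayOutputLevel
import Literature.MathematicalPhysics.QuantumFieldTheory.Balaban1983to89.B12Ineq418Flat
import Summits.QuantumFields.YangMills.Theorems.BalabanUVNodesN22KernelFadingOfStepRate

/-!
# BalabanUVNodes ∕ node N22 = NE9 — THE WINDOWED SECOND-DIFFERENCE LETTER FROM OUTPUT-LEVEL COUPLING MARGINS WITH A UNIFORM RADIUS: Cauchy at SECOND order in one
# young coupling of the (2.13) terms at complexified readings, carried through the soft window machinery of the (1.7) localized sum — the producer of module J38 §3's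
# `hW2` (and so of the UNIFORM constant `M` in dag-n22-a's discrete Landau–Kolmogorov knit at the kernels)

Cell `pub-ymgap`, HUMAN RULING D-0062 (Track A), R134 seat `pub-ymgap-dag-n22-c` (strategy s1), generation 14, module J39.  THEOREMS ONLY (no `def`, no `sorry`, standard axioms);
`--kind proof --supports stmt-QuantumFields-20544 --as helper` (K3⁷ `SpineGivenEndpointR13SepCoPH`, skeleton v5 941dddb108cb), COUNT-NEUTRAL.  Imports J36
`…Theorems.BalabanUVNodesN22WindowedDecayOutputLevel` (through it J29-soft `…N22WindowOfLocalizedSum`, J28 `…N22TermPolarizationLocalCauchy`, J27 `…N22WindowOfLocalTerms` and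
dag-n22-w2's `…N22WindowSoftTwoPointDomSys.eventually_le_of_softSum_domSys`) and the lineage's `B12Ineq418Flat` (`norm_secondDiff_le`: mixed second differences of a holomorphic
function from a sup bound — Cauchy at second order).  Nothing re-declared.

WHY (modules J37 ∕ J38).  K3⁷ v5 §2b's `h9` asks GEOMETRIC history moduli; the gain is node N18's kernel step rate (J38), and what N22's own lane must then supply is NOT a fading
table but a SECOND-DIFFERENCE bound on the windowed kernels in each young coupling with a constant UNIFORM in the age (J38 §3 `kernelSecondDiff_of_windowed`'s `hW2`).  THIS FILE
produces that letter from the SAME output-level datum J34 reads (`…WindowedNE9OutputLevel.windowedNE9_localizedSum_of_outputCoordHolo`'s `hL`), now with ONE radius `ρ₀`: per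
`(K, k, i)`, box prefix `g`, domain `X` and configuration `φ` of the space table, a holomorphic extension of `t ↦ E^{(k+1)}(X; g|g_i := t; φ)` to a set containing the closed
`ρ₀`-discs about `]0, γ]`, bounded by `B·e^{−κ_E d_{k+1}(X)}` — NO age-growing radii (J37 §3), uniform `ρ₀` suffices because the gain is elsewhere.
* §1 `norm_secondDiff_le_of_coordHolo` — COMPLEX ANALYSIS: such an extension has second differences `‖Ec(t+d) − 2Ec(t) + Ec(t−d)‖ ≤ (64B₀∕ρ₀²)·d²` for `t ± d ∈ ]0, γ]`
  (`B12Ineq418Flat.norm_secondDiff_le` on the `ρ₀`-ball about `t − d` for `d ≤ ρ₀∕4`; the trivial bound `4B₀` otherwise).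
* §2 `polScalar_add` ∕ `secondDiff_polWindow_localizedSum_eq` — (1.20) is ADDITIVE in the functional (J27 `polScalar_finset_sum` over `Bool`), so the second difference of the three
  windowed kernels IS the difference of the windowed kernels of two finite sums of local terms (`E₊ + E₋` against `E₀ + E₀`); ★ `abs_secondDiff_polWindow_localizedSum_le_soft` —
  the SOFT two-point bound `Σ_X 16·M(X)·r⁻²·w_X(z·)w_X(0·)` for it (J27 `abs_polScalar_sum_sub_le_twoPointSum` at `supp := univ` + J28 `hterm_of_holomorphic_weighted`), `M(X)` the
  per-term second difference on the complexified probe ball.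
* §3 ★★★ `windowedSecondDiff_localizedSum_of_outputCoordHolo` — THE LETTER: for every window history `g`, level `k`, entry `(μ, ν, z)`, coordinate `i ≤ k` and `t ± d ∈ ]0, γ]`,
  EVENTUALLY IN `K`: `|Π^{(K)}(g[i↦t+d]; z) − 2Π^{(K)}(g[i↦t]; z) + Π^{(K)}(g[i↦t−d]; z)| ≤ C₂·e^{−δ₁|z|₁}·d²`, `C₂ = (16·(64B∕ρ₀²)·B₃²∕r²)·e^{12Mδ₁}K₀(64,8)K₁(4,δ₀∕2)`,
  `δ₁ = ½min{δ₀, κ(4M)⁻¹}` — §1 per term at the complexified configurations `Φ z ∈ sp` + §2 + J36's `outputValueSummand_le_softMajorant` + dag-n22-w2's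
  `eventually_le_of_softSum_domSys`.  Exactly J38 §3's `hW2` shape at `(ℰ, W) := (localizedSum F S emb, Window γ)`; §4 `…_merged_of_localizes`: transferred to the merged term family
  of record under W1-20's law (`polWindow_eventuallyEq_of_eventuallyAgree`), i.e. J38 §3's `hW2` AT THE RECORD.

HONEST FRAMING (binding).  Count-neutral: Cauchy's estimate + kernel bookkeeping over DISPLAYED hypotheses; NO estimate of Bałaban's is proved or asserted — the output-level margin
datum (N09's `EHoloAt` road for the last coupling ∕ N10's «(or analytic)» transported to the terms for the older ones ∕ NODE A at the towers of record), term holomorphy through the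
readings, the readings' chart∕space clauses, the site-weight tails ([I] p. 282) and W1-20's law are HYPOTHESES with their owners; nothing of the record is constructed or claimed to meet
them; N22 is NOT discharged (typed 28∕28 · discharged 5∕27 UNCHANGED); K3⁷ OPEN and NOT claimed; NE9 is NOT IN PRINT for d = 4; no count claim; one finite 𝕋⁴ programme at fixed ε —
R4 closes the CONDITIONAL rung `BalabanLadder.UV` only; NOTHING about the continuum limit, ℝ⁴, infinite volume, OS axioms, a mass gap or the Clay problem is proved or claimed.
References (TYPES only, no cite tags on the Summit side): [I] = Bałaban, CMP 109 (1987) (1.7) p. 261, §1 p. 263 with (1.18), §2 p. 266, (1.20)–(1.21) p. 264, p. 282 (site-weight tails: the sentence after (4.4)), (4.35)–(4.37) pp. 290–291,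
(5.10) p. 293; [II] = CMP 116 (1988) (2.13)–(2.14) pp. 14–15.
-/

noncomputable section

open Filter Topology Set Metric
open scoped BigOperators

namespace YMDAG.N22.WindowedSecondDiff

open Literature.MathematicalPhysics.QuantumFieldTheory.Balaban1983to89
open Literature.MathematicalPhysics.QuantumFieldTheory.Balaban1983to89.T4Continuum (T4Family)
open Literature.MathematicalPhysics.QuantumFieldTheory.Balaban1983to89.T4OutputRate (Window)
open Literature.MathematicalPhysics.QuantumFieldTheory.Balaban1983to89.TreeLengthTorus (TPt torusTreeLen torusTreeLen_nonneg)
open Literature.MathematicalPhysics.QuantumFieldTheory.Balaban1983to89.B12TreeDecay (K₀ kappa₀ K₀_pos)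
open Literature.MathematicalPhysics.QuantumFieldTheory.Balaban1983to89.B12PolarizationTensor120 (polTensor polComp expChart expChart_apply)
open Literature.MathematicalPhysics.QuantumFieldTheory.Balaban1983to89.B12Decay510 (delta1)
open Literature.MathematicalPhysics.QuantumFieldTheory.Balaban1983to89.B12Decay510Window (K₁)
open Literature.MathematicalPhysics.QuantumFieldTheory.Balaban1983to89.B12Decay510Torus (distCT nearT)
open Literature.MathematicalPhysics.QuantumFieldTheory.Balaban1983to89.B12Sec2to5 (l1)
open Literature.MathematicalPhysics.QuantumFieldTheory.Balaban1983to89.B12Ineq418Flat (norm_secondDiff_le)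
open Literature.MathematicalPhysics.QuantumFieldTheory.Balaban1983to89.Node00 (TermFamily1 polScalar polWindow siteOfInt mergedTermFamilyMatT TβOfRecord₁₃ chiβOfRecord₁₃
  Stage13Params MatA)
open Literature.MathematicalPhysics.QuantumFieldTheory.Balaban1983to89.Node00.Sect2 (domSys domCount CPair)
open Literature.MathematicalPhysics.QuantumFieldTheory.Balaban1983to89.Node00.W1
open Literature.MathematicalPhysics.QuantumFieldTheory.Balaban1983to89.Node00.LocalizedSum17 (localizedSum ReadingMaps Localizes17OfRecord₁₃)
open Literature.MathematicalPhysics.QuantumFieldTheory.Balaban1983to89.Node00.U3OfKernels (histPrefix histPrefix_apply)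
open Literature.MathematicalPhysics.QuantumFieldTheory.Balaban1983to89.Node00.U3KernelLetters (polWindow_eventuallyEq_of_eventuallyAgree)
open YMDAG.N22.WindowOfLocalTerms (polScalar_finset_sum abs_polScalar_sum_sub_le_twoPointSum contDiffAt_two_of_holomorphic hterm_of_holomorphic_weighted)
open YMDAG.N22.WindowSoftTwoPoint (eventually_le_of_softSum_domSys)
open YMDAG.N22.OutputLevel (outputValueSummand_le_softMajorant)

/-! ## §1 Complex analysis: second differences of a bounded holomorphic extension about `]0, γ]` -/

/-- ★ **SECOND DIFFERENCES FROM A UNIFORM COUPLING MARGIN (Cauchy at second order).**  If `Ec` is holomorphic on a set `O ⊆ ℂ` containing the closed `ρ₀`-discs about every point of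
`]0, γ]` and `‖Ec‖ ≤ B₀` on `O`, then for `d > 0` with `t ± d ∈ ]0, γ]`: `‖Ec(t+d) − 2·Ec(t) + Ec(t−d)‖ ≤ (64B₀∕ρ₀²)·d²` — `B12Ineq418Flat.norm_secondDiff_le` on the open `ρ₀`-ball about
`t − d` (steps `V = W = d`, room `ρ₀∕4`) when `d ≤ ρ₀∕4`, the trivial bound `4B₀ ≤ 64B₀(d∕ρ₀)²` otherwise. [folklore] -/
theorem norm_secondDiff_le_of_coordHolo {Ec : ℂ → ℂ} {O : Set ℂ} {γ ρ₀ B₀ : ℝ} (hρ₀ : 0 < ρ₀) (hB₀ : 0 ≤ B₀)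
    (hhol : DifferentiableOn ℂ Ec O) (hball : ∀ s ∈ Ioc (0 : ℝ) γ, closedBall (s : ℂ) ρ₀ ⊆ O) (hbd : ∀ z ∈ O, ‖Ec z‖ ≤ B₀)
    {t d : ℝ} (hd : 0 < d) (hm : t - d ∈ Ioc (0 : ℝ) γ) (hp : t + d ∈ Ioc (0 : ℝ) γ) :
    ‖Ec ((t + d : ℝ) : ℂ) - 2 * Ec (t : ℂ) + Ec ((t - d : ℝ) : ℂ)‖ ≤ 64 * B₀ / ρ₀ ^ 2 * d ^ 2 := by
  have ht : t ∈ Ioc (0 : ℝ) γ := ⟨by linarith [hm.1], by linarith [hp.2]⟩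
  have hmemO : ∀ s ∈ Ioc (0 : ℝ) γ, (s : ℂ) ∈ O := fun s hs => hball s hs (mem_closedBall_self hρ₀.le)
  by_cases hdρ : d ≤ ρ₀ / 4
  · -- Cauchy at second order on the `ρ₀`-ball about `t − d`
    set p : ℂ := ((t - d : ℝ) : ℂ) with hp_def
    have hsub : ball p ρ₀ ⊆ O := (ball_subset_closedBall).trans (hball _ hm)
    have hholU : DifferentiableOn ℂ Ec (ball p ρ₀) := hhol.mono hsub
    have hnd : ‖(d : ℂ)‖ = d := by rw [Complex.norm_real, Real.norm_eq_abs, abs_of_pos hd]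
    have hmem : ∀ s s' : ℂ, ‖s‖ * ‖(d : ℂ)‖ < ‖(d : ℂ)‖ + ρ₀ / 4 → ‖s'‖ * ‖(d : ℂ)‖ < ‖(d : ℂ)‖ + ρ₀ / 4 →
        p + s • (d : ℂ) + s' • (d : ℂ) ∈ ball p ρ₀ := by
      intro s s' hs hs'
      rw [hnd] at hs hs'
      rw [mem_ball, dist_eq_norm, show p + s • (d : ℂ) + s' • (d : ℂ) - p = s • (d : ℂ) + s' • (d : ℂ) by ring]
      calc ‖s • (d : ℂ) + s' • (d : ℂ)‖ ≤ ‖s • (d : ℂ)‖ + ‖s' • (d : ℂ)‖ := norm_add_le _ _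
        _ = ‖s‖ * d + ‖s'‖ * d := by rw [norm_smul, norm_smul, hnd]
        _ < (d + ρ₀ / 4) + (d + ρ₀ / 4) := add_lt_add hs hs'
        _ ≤ ρ₀ := by linarith
    have h := norm_secondDiff_le (f := Ec) isOpen_ball hholU hB₀ (by positivity : (0 : ℝ) < ρ₀ / 4) p (d : ℂ) (d : ℂ) hmem
      (fun q hq => hbd q (hsub hq))
    have e1 : p + (d : ℂ) + (d : ℂ) = ((t + d : ℝ) : ℂ) := by rw [hp_def]; push_cast; ring
    have e2 : p + (d : ℂ) = (t : ℂ) := by rw [hp_def]; push_cast; ring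
    rw [e1, e2, show Ec ((t + d : ℝ) : ℂ) - Ec (t : ℂ) - Ec (t : ℂ) + Ec p = Ec ((t + d : ℝ) : ℂ) - 2 * Ec (t : ℂ) + Ec ((t - d : ℝ) : ℂ) by
      rw [hp_def]; ring, hnd] at h
    calc ‖Ec ((t + d : ℝ) : ℂ) - 2 * Ec (t : ℂ) + Ec ((t - d : ℝ) : ℂ)‖ ≤ B₀ * d * d / (ρ₀ / 4) ^ 2 := h
      _ = 16 * B₀ / ρ₀ ^ 2 * d ^ 2 := by field_simp; ring
      _ ≤ 64 * B₀ / ρ₀ ^ 2 * d ^ 2 := by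
          have h0 : 0 ≤ B₀ / ρ₀ ^ 2 * d ^ 2 := by positivity
          have e16 : 16 * B₀ / ρ₀ ^ 2 * d ^ 2 = 16 * (B₀ / ρ₀ ^ 2 * d ^ 2) := by ring
          have e64 : 64 * B₀ / ρ₀ ^ 2 * d ^ 2 = 64 * (B₀ / ρ₀ ^ 2 * d ^ 2) := by ring
          rw [e16, e64]; linarith
  · -- large step: the trivial bound
    have hdρ' : ρ₀ / 4 < d := lt_of_not_ge hdρ
    have h3 : ‖Ec ((t + d : ℝ) : ℂ) - 2 * Ec (t : ℂ) + Ec ((t - d : ℝ) : ℂ)‖ ≤ 4 * B₀ := by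
      have h1 := hbd _ (hmemO _ hp); have h2 := hbd _ (hmemO _ ht); have h3 := hbd _ (hmemO _ hm)
      calc ‖Ec ((t + d : ℝ) : ℂ) - 2 * Ec (t : ℂ) + Ec ((t - d : ℝ) : ℂ)‖
          ≤ ‖Ec ((t + d : ℝ) : ℂ) - 2 * Ec (t : ℂ)‖ + ‖Ec ((t - d : ℝ) : ℂ)‖ := norm_add_le _ _
        _ ≤ (‖Ec ((t + d : ℝ) : ℂ)‖ + ‖2 * Ec (t : ℂ)‖) + ‖Ec ((t - d : ℝ) : ℂ)‖ := by gcongr; exact norm_sub_le _ _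
        _ ≤ (B₀ + 2 * B₀) + B₀ := by
            gcongr
            rw [norm_mul, Complex.norm_ofNat]; linarith
        _ = 4 * B₀ := by ring
    have h4 : 4 * B₀ ≤ 64 * B₀ / ρ₀ ^ 2 * d ^ 2 := by
      rw [div_mul_eq_mul_div, le_div_iff₀ (by positivity)]
      have : ρ₀ ^ 2 ≤ 16 * d ^ 2 := by nlinarith
      nlinarith
    exact h3.trans h4

/-! ## §2 The second difference of the windowed kernels of a localized sum: additivity of (1.20), and the SOFT two-point bound -/

section Window

variable {𝔄 : Type*} [NormedRing 𝔄] [NormedAlgebra ℝ 𝔄] {V : Type*} [NormedAddCommGroup V] [NormedSpace ℝ V] {ι' : Type*} [Fintype ι']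

/-- **ADDITIVITY OF def-B's SCALAR KERNEL IN THE FUNCTIONAL** (two summands; J27 `polScalar_finset_sum` over `Bool`): each exponential chart twice continuously differentiable at `0`.
[folklore] -/
theorem polScalar_add {Λ T : Type*} [Fintype Λ] [Fintype T] [DecidableEq Λ] [DecidableEq T] (f g : (Λ → T → 𝔄) → ℝ) (ρ : V →L[ℝ] 𝔄) (bV : Module.Basis ι' ℝ V)
    (hf : ContDiffAt ℝ 2 (expChart f ρ) 0) (hg : ContDiffAt ℝ 2 (expChart g ρ) 0) (μ : Λ) (x : T) (ν : Λ) (y : T) :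
    polScalar (fun U => f U + g U) ρ bV μ x ν y = polScalar f ρ bV μ x ν y + polScalar g ρ bV μ x ν y := by
  have h := polScalar_finset_sum (Finset.univ : Finset Bool) (fun b => if b then f else g) ρ bV
    (fun b _ => by cases b <;> simpa) μ x ν y
  simp only [Fintype.sum_bool, if_true] at h
  simpa using h

variable {𝔸 : Type*} {M : ℕ} (F : T4Family) (S : (K : ℕ) → ClusterTower (F.P K) 𝔸 M) (emb : ReadingMaps F 𝔄 𝔸) (ρ : V →L[ℝ] 𝔄)
  (bV : Module.Basis ι' ℝ V) (k K : ℕ) (hp h0 hm : Fin (k + 1) → ℝ) {Ec : Type*} [NormedAddCommGroup Ec] [NormedSpace ℂ Ec]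

/-- **THE SECOND DIFFERENCE OF THE WINDOWED KERNELS IS A DIFFERENCE OF WINDOWED KERNELS OF TWO SUMS OF LOCAL TERMS** — `Π(h₊) − 2Π(h₀) + Π(h₋) = Π[Σ_X (E_X(h₊) + E_X(h₋))] −
Π[Σ_X (E_X(h₀) + E_X(h₀))]` (additivity of (1.20) in the functional), the terms read through complexifications holomorphic on open sets containing `ι X 0`. [folklore] -/
theorem secondDiff_polWindow_localizedSum_eq
    (ι : (domSys (F.P K) M (k + 1)).Dom → ((Fin (F.P K).d → Site (F.P K) (k + 1) → V) →L[ℝ] Ec))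
    (Gp G0 Gm : (domSys (F.P K) M (k + 1)).Dom → Ec → ℂ) (U : (domSys (F.P K) M (k + 1)).Dom → Set Ec) (hU : ∀ X, IsOpen (U X))
    (hGp : ∀ X, DifferentiableOn ℂ (Gp X) (U X)) (hG0 : ∀ X, DifferentiableOn ℂ (G0 X) (U X)) (hGm : ∀ X, DifferentiableOn ℂ (Gm X) (U X))
    (hι0 : ∀ X, ι X 0 ∈ U X)
    (hfp : ∀ X B, expChart (fun W => (((S K) k).E hp (emb K k W) X).re) ρ B = (Gp X (ι X B)).re)
    (hf0 : ∀ X B, expChart (fun W => (((S K) k).E h0 (emb K k W) X).re) ρ B = (G0 X (ι X B)).re)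
    (hfm : ∀ X B, expChart (fun W => (((S K) k).E hm (emb K k W) X).re) ρ B = (Gm X (ι X B)).re)
    (μ ν : Fin 4) (z : Fin 4 → ℤ) :
    polWindow F K (k + 1) (localizedSum F S emb k hp K) ρ bV μ ν z - 2 * polWindow F K (k + 1) (localizedSum F S emb k h0 K) ρ bV μ ν z +
        polWindow F K (k + 1) (localizedSum F S emb k hm K) ρ bV μ ν z =
      polWindow F K (k + 1) (fun W => ∑ X : (domSys (F.P K) M (k + 1)).Dom, ((((S K) k).E hp (emb K k W) X).re + (((S K) k).E hm (emb K k W) X).re)) ρ bV μ ν z -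
        polWindow F K (k + 1) (fun W => ∑ X : (domSys (F.P K) M (k + 1)).Dom, ((((S K) k).E h0 (emb K k W) X).re + (((S K) k).E h0 (emb K k W) X).re)) ρ bV μ ν z := by
  classical
  -- `C²` of every chart at `0`
  have cd : ∀ (h : Fin (k + 1) → ℝ) (G : (domSys (F.P K) M (k + 1)).Dom → Ec → ℂ), (∀ X, DifferentiableOn ℂ (G X) (U X)) →
      (∀ X B, expChart (fun W => (((S K) k).E h (emb K k W) X).re) ρ B = (G X (ι X B)).re) →
      ∀ X, ContDiffAt ℝ 2 (expChart (fun W => (((S K) k).E h (emb K k W) X).re) ρ) 0 := by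
    intro h G hG hf X
    rw [show expChart (fun W => (((S K) k).E h (emb K k W) X).re) ρ = fun B => (G X (ι X B)).re from funext (hf X)]
    exact contDiffAt_two_of_holomorphic (G X) (hG X) (hU X) (ι X) (hι0 X)
  have cdp := cd hp Gp hGp hfp
  have cd0 := cd h0 G0 hG0 hf0
  have cdm := cd hm Gm hGm hfm
  -- unfold the three windows into sums of per-term scalar kernels
  have up : localizedSum F S emb k hp K = fun U => ∑ X : (domSys (F.P K) M (k + 1)).Dom, (((S K) k).E hp (emb K k U) X).re := rfl
  have u0 : localizedSum F S emb k h0 K = fun U => ∑ X : (domSys (F.P K) M (k + 1)).Dom, (((S K) k).E h0 (emb K k U) X).re := rfl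
  have um : localizedSum F S emb k hm K = fun U => ∑ X : (domSys (F.P K) M (k + 1)).Dom, (((S K) k).E hm (emb K k U) X).re := rfl
  rw [up, u0, um]
  simp only [polWindow]
  rw [polScalar_finset_sum Finset.univ _ ρ bV (fun X _ => cdp X), polScalar_finset_sum Finset.univ _ ρ bV (fun X _ => cd0 X),
    polScalar_finset_sum Finset.univ _ ρ bV (fun X _ => cdm X)]
  -- the two sums of local terms: chart of a sum of two terms is `C²`
  have cdpm : ∀ X ∈ (Finset.univ : Finset (domSys (F.P K) M (k + 1)).Dom),
      ContDiffAt ℝ 2 (expChart (fun W => (((S K) k).E hp (emb K k W) X).re + (((S K) k).E hm (emb K k W) X).re) ρ) 0 := by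
    intro X _
    have e : expChart (fun W => (((S K) k).E hp (emb K k W) X).re + (((S K) k).E hm (emb K k W) X).re) ρ =
        fun B => expChart (fun W => (((S K) k).E hp (emb K k W) X).re) ρ B + expChart (fun W => (((S K) k).E hm (emb K k W) X).re) ρ B := by
      funext B; simp only [expChart_apply]
    rw [e]; exact (cdp X).add (cdm X)
  have cd00 : ∀ X ∈ (Finset.univ : Finset (domSys (F.P K) M (k + 1)).Dom),
      ContDiffAt ℝ 2 (expChart (fun W => (((S K) k).E h0 (emb K k W) X).re + (((S K) k).E h0 (emb K k W) X).re) ρ) 0 := by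
    intro X _
    have e : expChart (fun W => (((S K) k).E h0 (emb K k W) X).re + (((S K) k).E h0 (emb K k W) X).re) ρ =
        fun B => expChart (fun W => (((S K) k).E h0 (emb K k W) X).re) ρ B + expChart (fun W => (((S K) k).E h0 (emb K k W) X).re) ρ B := by
      funext B; simp only [expChart_apply]
    rw [e]; exact (cd0 X).add (cd0 X)
  rw [polScalar_finset_sum Finset.univ _ ρ bV cdpm, polScalar_finset_sum Finset.univ _ ρ bV cd00]
  simp only [polScalar_add _ _ ρ bV (cdp _) (cdm _), polScalar_add _ _ ρ bV (cd0 _) (cd0 _), Finset.sum_add_distrib]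
  ring

/-- ★ **THE SOFT TWO-POINT BOUND FOR THE SECOND DIFFERENCE OF THE WINDOWED KERNELS.**  For node00-def-W1's term family `localizedSum F S emb` at three coupling prefixes `h₊, h₀, h₋`: if every
term `X`, read in def-B's exponential chart, is at each of the three prefixes the real part of a function `G₊ X ∕ G₀ X ∕ G₋ X` holomorphic on an open `U X ⊇ ball 0 r` through a per-term
real-linear complexification `ι X` with SITE-WEIGHTED one-site colour directions `‖ι X e_{l,t,c}‖ ≤ w X t` (`w ≥ 0`), and the per-term second difference obeys
`‖G₊ X − 2G₀ X + G₋ X‖ ≤ M X` on the ball, then `|Π(h₊; z) − 2Π(h₀; z) + Π(h₋; z)| ≤ Σ_X 16·M(X)·r⁻²·w_X(z·)·w_X(0·)` — §2's identity + J27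
`abs_polScalar_sum_sub_le_twoPointSum` at `supp := univ` + J28 `hterm_of_holomorphic_weighted` on the pair `(G₊ + G₋, G₀ + G₀)`. [folklore] -/
theorem abs_secondDiff_polWindow_localizedSum_le_soft
    (ι : (domSys (F.P K) M (k + 1)).Dom → ((Fin (F.P K).d → Site (F.P K) (k + 1) → V) →L[ℝ] Ec))
    (Gp G0 Gm : (domSys (F.P K) M (k + 1)).Dom → Ec → ℂ) (U : (domSys (F.P K) M (k + 1)).Dom → Set Ec) (hU : ∀ X, IsOpen (U X))
    (hGp : ∀ X, DifferentiableOn ℂ (Gp X) (U X)) (hG0 : ∀ X, DifferentiableOn ℂ (G0 X) (U X)) (hGm : ∀ X, DifferentiableOn ℂ (Gm X) (U X))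
    {r : ℝ} (hr : 0 < r) (hrU : ∀ X, ball (0 : Ec) r ⊆ U X)
    (hfp : ∀ X B, expChart (fun W => (((S K) k).E hp (emb K k W) X).re) ρ B = (Gp X (ι X B)).re)
    (hf0 : ∀ X B, expChart (fun W => (((S K) k).E h0 (emb K k W) X).re) ρ B = (G0 X (ι X B)).re)
    (hfm : ∀ X B, expChart (fun W => (((S K) k).E hm (emb K k W) X).re) ρ B = (Gm X (ι X B)).re)
    (Mx : (domSys (F.P K) M (k + 1)).Dom → ℝ) (hM : ∀ X, ∀ z ∈ ball (0 : Ec) r, ‖Gp X z - 2 * G0 X z + Gm X z‖ ≤ Mx X)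
    (w : (domSys (F.P K) M (k + 1)).Dom → Site (F.P K) (k + 1) → ℝ)
    (hw₀ : ∀ X t, 0 ≤ w X t) (hw : ∀ X (l : Fin (F.P K).d) (t : Site (F.P K) (k + 1)) (c : ι'), ‖ι X (Pi.single l (Pi.single t (bV c)))‖ ≤ w X t)
    (μ ν : Fin 4) (z : Fin 4 → ℤ) :
    |polWindow F K (k + 1) (localizedSum F S emb k hp K) ρ bV μ ν z - 2 * polWindow F K (k + 1) (localizedSum F S emb k h0 K) ρ bV μ ν z +
        polWindow F K (k + 1) (localizedSum F S emb k hm K) ρ bV μ ν z| ≤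
      ∑ X : (domSys (F.P K) M (k + 1)).Dom, 16 * Mx X / r ^ 2 * (w X (siteOfInt F K (k + 1) z) * w X (siteOfInt F K (k + 1) 0)) := by
  classical
  have hι0 : ∀ X, ι X 0 ∈ U X := fun X => by rw [map_zero]; exact hrU X (mem_ball_self hr)
  have hM0 : ∀ X, 0 ≤ Mx X := fun X => (norm_nonneg _).trans (hM X 0 (mem_ball_self hr))
  rw [secondDiff_polWindow_localizedSum_eq F S emb ρ bV k K hp h0 hm ι Gp G0 Gm U hU hGp hG0 hGm hι0 hfp hf0 hfm μ ν z]
  -- the pair of local-term families and their complexifications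
  have hfpm : ∀ X B, expChart (fun W => (((S K) k).E hp (emb K k W) X).re + (((S K) k).E hm (emb K k W) X).re) ρ B =
      ((fun z => Gp X z + Gm X z) (ι X B)).re := fun X B => by
    have h1 := hfp X B; have h2 := hfm X B
    simp only [expChart_apply] at h1 h2 ⊢
    rw [h1, h2, Complex.add_re]
  have hf00 : ∀ X B, expChart (fun W => (((S K) k).E h0 (emb K k W) X).re + (((S K) k).E h0 (emb K k W) X).re) ρ B =
      ((fun z => G0 X z + G0 X z) (ι X B)).re := fun X B => by
    have h1 := hf0 X B
    simp only [expChart_apply] at h1 ⊢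
    rw [h1, Complex.add_re]
  have hGpm : ∀ X, DifferentiableOn ℂ (fun z => Gp X z + Gm X z) (U X) := fun X => (hGp X).add (hGm X)
  have hG00 : ∀ X, DifferentiableOn ℂ (fun z => G0 X z + G0 X z) (U X) := fun X => (hG0 X).add (hG0 X)
  have hM' : ∀ X, ∀ z ∈ ball (0 : Ec) r, ‖(Gp X z + Gm X z) - (G0 X z + G0 X z)‖ ≤ Mx X := fun X z hz => by
    rw [show (Gp X z + Gm X z) - (G0 X z + G0 X z) = Gp X z - 2 * G0 X z + Gm X z by ring]; exact hM X z hz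
  have h := abs_polScalar_sum_sub_le_twoPointSum Finset.univ
    (fun X W => (((S K) k).E hp (emb K k W) X).re + (((S K) k).E hm (emb K k W) X).re)
    (fun X W => (((S K) k).E h0 (emb K k W) X).re + (((S K) k).E h0 (emb K k W) X).re) ρ bV
    (fun X _ => by rw [show expChart (fun W => (((S K) k).E hp (emb K k W) X).re + (((S K) k).E hm (emb K k W) X).re) ρ =
        fun B => ((fun z => Gp X z + Gm X z) (ι X B)).re from funext (hfpm X)]
                   exact contDiffAt_two_of_holomorphic _ (hGpm X) (hU X) (ι X) (hι0 X))
    (fun X _ => by rw [show expChart (fun W => (((S K) k).E h0 (emb K k W) X).re + (((S K) k).E h0 (emb K k W) X).re) ρ =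
        fun B => ((fun z => G0 X z + G0 X z) (ι X B)).re from funext (hf00 X)]
                   exact contDiffAt_two_of_holomorphic _ (hG00 X) (hU X) (ι X) (hι0 X))
    (fun _ => (Set.univ : Set (Site (F.P K) (k + 1))))
    (fun X => 16 * Mx X / r ^ 2 * (w X (siteOfInt F K (k + 1) z) * w X (siteOfInt F K (k + 1) 0)))
    (fun X _ => by have := hM0 X; have := hw₀ X (siteOfInt F K (k + 1) z); have := hw₀ X (siteOfInt F K (k + 1) 0); positivity)
    (Fin.cast (F.P_d K).symm μ) (siteOfInt F K (k + 1) z) (Fin.cast (F.P_d K).symm ν) (siteOfInt F K (k + 1) 0)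
    (fun X _ c => by
      rw [if_pos ⟨Set.mem_univ _, Set.mem_univ _⟩]
      exact hterm_of_holomorphic_weighted _ _ ρ bV _ _ (hGpm X) (hG00 X) (hU X) hr (hrU X) (hM' X) (ι X) (hfpm X) (hf00 X) (w X) (hw X) _ _ _ _ c)
  rw [Finset.filter_true_of_mem (fun X _ => ⟨Set.mem_univ _, Set.mem_univ _⟩)] at h
  exact h

end Window

/-! ## §3 ★★★ THE WINDOWED SECOND-DIFFERENCE LETTER from output-level coupling margins with ONE radius -/

section Letter

variable (F : T4Family) {𝔄 : Type*} [NormedRing 𝔄] [NormedAlgebra ℝ 𝔄] {V : Type*} [NormedAddCommGroup V] [NormedSpace ℝ V]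
  {ι' : Type*} [Fintype ι'] {𝔸 : Type*} {M : ℕ}

/-- The history prefix of an updated sequence is the updated prefix. [folklore] -/
theorem histPrefix_update (g : ℕ → ℝ) (k : ℕ) {i : ℕ} (hi : i < k + 1) (s : ℝ) :
    histPrefix (Function.update g i s) k = Function.update (histPrefix g k) ⟨i, hi⟩ s := by
  funext j
  by_cases hj : (j : ℕ) = i
  · have e : j = ⟨i, hi⟩ := Fin.ext hj
    subst e
    rw [histPrefix_apply, Function.update_self, Function.update_self]
  · rw [histPrefix_apply, Function.update_of_ne hj, Function.update_of_ne (fun h => hj (congrArg Fin.val h)), histPrefix_apply]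

open Classical in
/-- ★★★ **THE WINDOWED SECOND-DIFFERENCE LETTER FROM OUTPUT-LEVEL COUPLING MARGINS WITH ONE RADIUS.**  For node00-def-W1's term family `localizedSum F S emb` on the window `]0, γ]^ℕ`, cube
side `M = L^{m′}`: IF per `(K, k, i)`, box prefix `g`, domain `X` and configuration `φ ∈ sp K k X` the (2.13) term `t ↦ E^{(k+1)}(X; g|g_i := t; φ)` extends holomorphically to a set
containing the closed `ρ₀`-discs about `]0, γ]` with the bound `B·e^{−κ_E d_{k+1}(X)}` (J34's OUTPUT-LEVEL margin datum `hL` at the UNIFORM radius `ρ₀ > 0`; `0 ≤ B`, `κ ≤ κ_E`); IF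
per `(K, k, X)` the complexified probe reading `Φ K k X` on an open `U K k X ⊇ ball 0 r` extends the exponential chart's reading, maps the ball into `sp K k X` and makes every term
`z ↦ E^{(k+1)}(X; histPrefix g k; Φ K k X z)` holomorphic for EVERY window history; IF the site weights carry the tails `w ≤ B₃e^{−δ₀ distCT(·, X)}`, `δ₀ > 0`, `2κ₀(64,8) ≤ κ`: THEN for
every window history `g`, level `k`, entry `(μ, ν, z)`, young coupling `i ≤ k` and `d > 0` with `t ± d ∈ ]0, γ]`, EVENTUALLY IN THE VOLUME INDEX `K`,
`|Π^{(K)}(g[i↦t+d]; z) − 2Π^{(K)}(g[i↦t]; z) + Π^{(K)}(g[i↦t−d]; z)| ≤ C₂·e^{−δ₁|z|₁}·d²`, `C₂ = (16·(64B∕ρ₀²)·B₃²∕r²)·e^{3·4M·δ₁}K₀(64,8)K₁(4,δ₀∕2)`, `δ₁ = ½min{δ₀, κ(4M)⁻¹}` —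
module J38 §3's `hW2` at `(ℰ, W) := (localizedSum F S emb, Window γ)` with a constant UNIFORM in the age. [folklore] -/
theorem windowedSecondDiff_localizedSum_of_outputCoordHolo (m' : ℕ) (M : ℕ) [NeZero M] (hM : M = F.L ^ m')
    (S : (K : ℕ) → ClusterTower (F.P K) 𝔸 M) (emb : ReadingMaps F 𝔄 𝔸) (ρ : V →L[ℝ] 𝔄) (bV : Module.Basis ι' ℝ V)
    {γ : ℝ} (sp : (K k : ℕ) → (domSys (F.P K) M (k + 1)).Dom → Set (CPair (F.P K) 𝔸))
    {κ κE δ₀ B₃ r B ρ₀ : ℝ} (hρ₀ : 0 < ρ₀)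
    (hκ₀ : kappa₀ (4 * 2 ^ 4) (2 * 4) ≤ κ / 2) (hδ₀ : 0 < δ₀) (hB₃ : 0 ≤ B₃) (hr : 0 < r) (hB : 0 ≤ B) (hκE : κ ≤ κE)
    (hL : ∀ (K k : ℕ) (i : Fin (k + 1)), ∀ g ∈ box γ k, ∀ (X : (domSys (F.P K) M (k + 1)).Dom), ∀ φ ∈ sp K k X,
      ∃ (Ec : ℂ → ℂ) (O : Set ℂ), DifferentiableOn ℂ Ec O ∧ (∀ t ∈ Ioc (0 : ℝ) γ, closedBall (t : ℂ) ρ₀ ⊆ O) ∧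
        (∀ z ∈ O, ‖Ec z‖ ≤ B * Real.exp (-(κE * (domSys (F.P K) M (k + 1)).dj X))) ∧
        (∀ t ∈ Ioc (0 : ℝ) γ, Ec t = ((S K) k).E (Function.update g i t) φ X))
    (Ec : ℕ → ℕ → Type*) [∀ K k, NormedAddCommGroup (Ec K k)] [∀ K k, NormedSpace ℂ (Ec K k)]
    (ι : (K k : ℕ) → (domSys (F.P K) M (k + 1)).Dom → ((Fin (F.P K).d → Site (F.P K) (k + 1) → V) →L[ℝ] Ec K k))
    (Φ : (K k : ℕ) → (domSys (F.P K) M (k + 1)).Dom → Ec K k → CPair (F.P K) 𝔸)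
    (U : (K k : ℕ) → (domSys (F.P K) M (k + 1)).Dom → Set (Ec K k)) (hU : ∀ K k X, IsOpen (U K k X)) (hrU : ∀ K k X, ball (0 : Ec K k) r ⊆ U K k X)
    (hEhol : ∀ g ∈ Window γ, ∀ (K k : ℕ) (X : (domSys (F.P K) M (k + 1)).Dom),
      DifferentiableOn ℂ (fun z => ((S K) k).E (histPrefix g k) (Φ K k X z) X) (U K k X))
    (hΦemb : ∀ (K k : ℕ) (X : (domSys (F.P K) M (k + 1)).Dom) (Bf : Fin (F.P K).d → Site (F.P K) (k + 1) → V),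
      Φ K k X (ι K k X Bf) = emb K k (fun l t => NormedSpace.exp (ρ (Bf l t))))
    (hΦsp : ∀ (K k : ℕ) (X : (domSys (F.P K) M (k + 1)).Dom), ∀ z ∈ ball (0 : Ec K k) r, Φ K k X z ∈ sp K k X)
    (w : (K k : ℕ) → (domSys (F.P K) M (k + 1)).Dom → Site (F.P K) (k + 1) → ℝ) (hw₀ : ∀ K k X t, 0 ≤ w K k X t)
    (hw : ∀ (K k : ℕ) (X : (domSys (F.P K) M (k + 1)).Dom) (l : Fin (F.P K).d) (t : Site (F.P K) (k + 1)) (c : ι'),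
      ‖ι K k X (Pi.single l (Pi.single t (bV c)))‖ ≤ w K k X t)
    (htail : ∀ (K k : ℕ) (X : (domSys (F.P K) M (k + 1)).Dom) (t : Site (F.P K) (k + 1)),
      let e : Site (F.P K) (k + 1) → TPt 4 (domCount (F.P K) M (k + 1) * M) := fun x i => (ZMod.cast (x i) : ZMod (domCount (F.P K) M (k + 1) * M))
      w K k X t ≤ B₃ * Real.exp (-δ₀ * distCT (domCount (F.P K) M (k + 1)) M (e t) (nearT (M := M) (e t) X))) :
    ∀ g ∈ Window γ, ∀ (k : ℕ) (μ ν : Fin 4) (z : Fin 4 → ℤ) (i : ℕ), i < k + 1 → ∀ t d : ℝ, 0 < d →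
      t - d ∈ Ioc (0 : ℝ) γ → t + d ∈ Ioc (0 : ℝ) γ → ∀ᶠ K in atTop,
        |polWindow F K (k + 1) (localizedSum F S emb k (histPrefix (Function.update g i (t + d)) k) K) ρ bV μ ν z -
            2 * polWindow F K (k + 1) (localizedSum F S emb k (histPrefix (Function.update g i t) k) K) ρ bV μ ν z +
            polWindow F K (k + 1) (localizedSum F S emb k (histPrefix (Function.update g i (t - d)) k) K) ρ bV μ ν z| ≤
          (16 * (64 * B / ρ₀ ^ 2) * B₃ ^ 2 / r ^ 2) * Real.exp (delta1 δ₀ κ ((M : ℝ) * 4) * ((M : ℝ) * 4) * 3) * K₀ (4 * 2 ^ 4) (2 * 4) *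
            K₁ 4 (δ₀ / 2) * d ^ 2 * Real.exp (-(delta1 δ₀ κ ((M : ℝ) * 4) * l1 z)) := by
  intro g hg k μ ν z i hi t d hd hmI hpI
  have htI : t ∈ Ioc (0 : ℝ) γ := ⟨by linarith [hmI.1], by linarith [hpI.2]⟩
  -- the three updated histories are window histories; their prefixes are updates of the prefix of `g`
  have hgp : Function.update g i (t + d) ∈ Window γ := YMDAG.N22.KernelFading.update_mem_window hg i hpI
  have hg0 : Function.update g i t ∈ Window γ := YMDAG.N22.KernelFading.update_mem_window hg i htI
  have hgm : Function.update g i (t - d) ∈ Window γ := YMDAG.N22.KernelFading.update_mem_window hg i hmI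
  have hbox : histPrefix g k ∈ box γ k := YMDAG.N22.WindowedOfCouplingHolo.histPrefix_mem_box hg k
  set iF : Fin (k + 1) := ⟨i, hi⟩ with hiF
  have ep : histPrefix (Function.update g i (t + d)) k = Function.update (histPrefix g k) iF (t + d) := histPrefix_update g k hi _
  have e0 : histPrefix (Function.update g i t) k = Function.update (histPrefix g k) iF t := histPrefix_update g k hi _
  have em : histPrefix (Function.update g i (t - d)) k = Function.update (histPrefix g k) iF (t - d) := histPrefix_update g k hi _
  -- the per-term second-difference bound on the complexified probe ball (§1 at `φ := Φ K k X z ∈ sp`)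
  have hMx : ∀ (K : ℕ) (X : (domSys (F.P K) M (k + 1)).Dom), ∀ zz ∈ ball (0 : Ec K k) r,
      ‖((S K) k).E (histPrefix (Function.update g i (t + d)) k) (Φ K k X zz) X - 2 * ((S K) k).E (histPrefix (Function.update g i t) k) (Φ K k X zz) X +
          ((S K) k).E (histPrefix (Function.update g i (t - d)) k) (Φ K k X zz) X‖ ≤
        64 * (B * Real.exp (-(κE * (domSys (F.P K) M (k + 1)).dj X))) / ρ₀ ^ 2 * d ^ 2 := by
    intro K X zz hzz
    obtain ⟨Ecf, O, hhol, hball, hbd, heq⟩ := hL K k iF (histPrefix g k) hbox X (Φ K k X zz) (hΦsp K k X zz hzz)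
    have hB₀ : 0 ≤ B * Real.exp (-(κE * (domSys (F.P K) M (k + 1)).dj X)) := by positivity
    have h := norm_secondDiff_le_of_coordHolo hρ₀ hB₀ hhol hball hbd hd hmI hpI
    rw [heq _ hpI, heq _ htI, heq _ hmI] at h
    rw [ep, e0, em]
    exact h
  have hD : ∀ K : ℕ,
      |polWindow F K (k + 1) (localizedSum F S emb k (histPrefix (Function.update g i (t + d)) k) K) ρ bV μ ν z -
          2 * polWindow F K (k + 1) (localizedSum F S emb k (histPrefix (Function.update g i t) k) K) ρ bV μ ν z +
          polWindow F K (k + 1) (localizedSum F S emb k (histPrefix (Function.update g i (t - d)) k) K) ρ bV μ ν z| ≤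
        ∑ X : (domSys (F.P K) M (k + 1)).Dom, 16 * (64 * (B * Real.exp (-(κE * torusTreeLen X.1))) / ρ₀ ^ 2 * d ^ 2) / r ^ 2 *
          (w K k X (siteOfInt F K (k + 1) z) * w K k X (siteOfInt F K (k + 1) 0)) := fun K =>
    abs_secondDiff_polWindow_localizedSum_le_soft F S emb ρ bV k K _ _ _ (ι K k)
      (fun X zz => ((S K) k).E (histPrefix (Function.update g i (t + d)) k) (Φ K k X zz) X)
      (fun X zz => ((S K) k).E (histPrefix (Function.update g i t) k) (Φ K k X zz) X)
      (fun X zz => ((S K) k).E (histPrefix (Function.update g i (t - d)) k) (Φ K k X zz) X)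
      (U K k) (hU K k) (fun X => hEhol _ hgp K k X) (fun X => hEhol _ hg0 K k X) (fun X => hEhol _ hgm K k X) hr (hrU K k)
      (fun X Bf => by rw [expChart_apply, hΦemb]) (fun X Bf => by rw [expChart_apply, hΦemb]) (fun X Bf => by rw [expChart_apply, hΦemb])
      (fun X => 64 * (B * Real.exp (-(κE * torusTreeLen X.1))) / ρ₀ ^ 2 * d ^ 2) (fun X zz hzz => hMx K X zz hzz) (w K k) (hw₀ K k) (hw K k) μ ν z
  -- soft majorants with the uniform letter `64B∕ρ₀²·d²` in the place of `B`
  have hB' : 0 ≤ 64 * B / ρ₀ ^ 2 * d ^ 2 := by positivity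
  have hCE : (0 : ℝ) ≤ 16 * (64 * B / ρ₀ ^ 2 * d ^ 2) * B₃ ^ 2 / r ^ 2 := by positivity
  have h := eventually_le_of_softSum_domSys F (k + 1) m' M hM
    (fun K => |polWindow F K (k + 1) (localizedSum F S emb k (histPrefix (Function.update g i (t + d)) k) K) ρ bV μ ν z -
        2 * polWindow F K (k + 1) (localizedSum F S emb k (histPrefix (Function.update g i t) k) K) ρ bV μ ν z +
        polWindow F K (k + 1) (localizedSum F S emb k (histPrefix (Function.update g i (t - d)) k) K) ρ bV μ ν z|)
    (fun K X => 16 * (64 * (B * Real.exp (-(κE * torusTreeLen X.1))) / ρ₀ ^ 2 * d ^ 2) / r ^ 2 *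
      (w K k X (siteOfInt F K (k + 1) z) * w K k X (siteOfInt F K (k + 1) 0)))
    hCE zero_le_one hδ₀ hκ₀ z hD (fun K X => ?_)
  · filter_upwards [h] with K hK
    refine hK.trans (le_of_eq ?_)
    ring
  · have e : 16 * (64 * (B * Real.exp (-(κE * torusTreeLen X.1))) / ρ₀ ^ 2 * d ^ 2) / r ^ 2 *
        (w K k X (siteOfInt F K (k + 1) z) * w K k X (siteOfInt F K (k + 1) 0)) =
        16 * ((64 * B / ρ₀ ^ 2 * d ^ 2) * Real.exp (-(κE * torusTreeLen X.1))) / r ^ 2 *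
          (w K k X (siteOfInt F K (k + 1) z) * w K k X (siteOfInt F K (k + 1) 0)) := by ring
    rw [e]
    exact outputValueSummand_le_softMajorant hB' hr hB₃ (hw₀ K k X _) (Real.exp_nonneg _) (Real.exp_nonneg _) (htail K k X _) (htail K k X _) hκE
      (torusTreeLen_nonneg _)

end Letter

end YMDAG.N22.WindowedSecondDiff

end
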